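import Mathlib.AlgebraicGeometry.ProjectiveSpectrum.Functor
import Mathlib.AlgebraicGeometry.Morphisms.ClosedImmersion
import Mathlib.RingTheory.MvPolynomial.Homogeneous
import Mathlib.RingTheory.TensorProduct.MvPolynomial
import Mathlib.RingTheory.Localization.BaseChange
import Mathlib.RingTheory.Flat.Basic
import Mathlib.Algebra.Category.Ring.Constructions
import Literature.AlgebraicGeometry.Motives.Varieties
import Literature.AlgebraicGeometry.Motives.BaseChange
import HarnessLib

/-!
# Base change of projective space and of smooth projective varieties (proofs for `BaseChange`)

This file discharges the named facts `Literature.AlgebraicGeometry.Motives.IsSmoothProjective.baseChangeHom`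
(`Motives/BaseChange.lean`), `Literature.AlgebraicGeometry.Motives.IsSmoothProjective.baseChange` (`Motives/Varieties.lean`) and
`Literature.AlgebraicGeometry.Motives.IsSmoothProjective.conjugateVariety` (`Motives/BaseChange.lean`): smooth projective
(geometrically irreducible) varieties of dimension `n` are stable under extension of the base
field. Smoothness of relative dimension `n` and geometric irreducibility are stable under base
change in Mathlib (`smoothOfRelativeDimension_isStableUnderBaseChange`, the
`GeometricallyIrreducible` instance on `pullback.snd`); the missing ingredient is projectivity,
i.e. that projective space commutes with base change, `ℙⁿ_k ×_{Spec k} Spec L ≅ ℙⁿ_L`, which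
Mathlib does not have (it has `Proj`, its functoriality `Proj.map`, and the affine charts
`Proj.awayι`, `Proj.affineOpenCover`).

We follow Liu, *Algebraic Geometry and Arithmetic Curves*, Prop. 3.1.9
(`Proj (B ⊗_A C) ≃ Proj B ×_{Spec A} Spec C`) in the case `B = k[x₀,…,x_N]`, `C = L`
(his Example 3.1.10, `(ℙⁿ_A)_C = ℙⁿ_C`): the comparison morphism `h : Proj L[xᵢ] → Proj k[xᵢ] ×ₖ L`
satisfies `h⁻¹(D₊(f) ×ₖ L) = D₊(φ f)`, so it suffices that
`ψ : k[xᵢ]⁰_(f) ⊗ₖ L → L[xᵢ]⁰_(φ f)` is an isomorphism; `ψ` is clearly surjective, and injective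
because `k[xᵢ]⁰_(f) ⊆ k[xᵢ]_f`, `L` is flat over `k`, and `k[xᵢ]_f ⊗ₖ L ≃ L[xᵢ]_{φ f}`.
In Lean the reduction to the charts is Mathlib's `Scheme.isPullback_of_openCover` for the cover
`Proj.affineOpenCover`, and each chart is `isPullback_SpecMap_of_isPushout` of the ring-theoretic
pushout square given by `ψ`.

## Main results

* `Literature.AlgebraicGeometry.Motives.ProjBaseChange.algebraBase`: the `R`-algebra structure on homogeneous localizations of a
  graded `R`-algebra (Mathlib only has the `𝒜 0`-algebra structure); a local instance here.
* `Literature.AlgebraicGeometry.Motives.ProjBaseChange.mapGraded`: `k[xᵢ] → L[xᵢ]` as a graded ring homomorphism, and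
  `irrelevant_le_map` (the hypothesis of Mathlib's `Proj.map`).
* `Literature.AlgebraicGeometry.Motives.ProjBaseChange.tensorToAway`, `tensorToAway_bijective`: Liu's `ψ` is bijective.
* `Literature.AlgebraicGeometry.Motives.ProjBaseChange.isPullback_projMap`: `Proj L[xᵢ]` with `Proj.map` and its structure map is
  the fibre product `Proj k[xᵢ] ×_{Spec k} Spec L` (Liu 3.1.9 / 3.1.10).
* `Literature.AlgebraicGeometry.Motives.projectiveSpaceBaseChangeIso`: `projectiveSpace n L ≅ (baseChange k L).obj (projectiveSpace n k)`
  in `SchemeOver L`.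
* `Literature.AlgebraicGeometry.Motives.IsProjectiveOver.baseChange_obj`, `Literature.AlgebraicGeometry.Motives.IsSmoothProjective.baseChange_obj`: base change of
  (smooth) projective `k`-schemes along `[Algebra k L]`.
* `Literature.AlgebraicGeometry.Motives.IsSmoothProjective.baseChange_holds`, `Literature.AlgebraicGeometry.Motives.IsSmoothProjective.baseChangeHom_holds`,
  `Literature.AlgebraicGeometry.Motives.IsSmoothProjective.conjugateVariety_holds`: the discharges.

## Design notes

* Everything is proved for an algebra structure `[Algebra k L]`; the `σ : k →+* L` versions follow
  with `σ.toAlgebra`, since `Literature.baseChangeHom σ` is `Over.pullback (Spec.map σ)` and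
  `algebraMap k L = σ` definitionally (`Literature.AlgebraicGeometry.Motives.baseChangeHom_algebraMap`).
* The only algebra structure we put on a homogeneous localization `A⁰ₓ` of a graded `R`-algebra is
  `algebraBase : Algebra R A⁰ₓ` (a local instance; its scalar multiplication is Mathlib's). The
  `k`-algebra structure on `L[xᵢ]⁰_(t)` needed to speak of `ψ` as a `k`-algebra map is taken as a
  hypothesis `[Algebra k L[xᵢ]⁰_(t)] [IsScalarTower k L L[xᵢ]⁰_(t)]` in the section on `ψ`, and is
  supplied by restriction of scalars (`algebraRestrict`, a plain definition used through `letI`)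
  where `ψ` is used; no instance priorities are involved.
* In the `Proj` section the index type of the variables lives in `Type` (as `Fin (n+1)` does), so
  that `Proj k[xᵢ]` and `Spec k` are schemes in the same universe.
* Local instances: Mathlib's non-instance definitions `MvPolynomial.gradedAlgebra` and
  `MvPolynomial.algebraMvPolynomial` (as Mathlib itself does locally), `algebraBase`, and the
  auxiliary `algebraLocalizationAway` (`L[xᵢ][1/s]` over `k[xᵢ][1/s]`) with its scalar towers.

## References

* Q. Liu, *Algebraic Geometry and Arithmetic Curves*, Oxford GTM 6 (2002): Prop. 3.1.9 and its
  proof (p. 81–82), Example 3.1.10, Remark 3.1.20, Prop. 3.1.23 (closed immersions and base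
  change), Prop. 4.3.38 (smooth morphisms and base change).
* R. Hartshorne, *Algebraic Geometry*, II Ex. 3.11(a), III Prop. 10.1(b).
* The Stacks project, Tags 01VB (base change of smooth morphisms), 054P (geometric
  irreducibility and field extension), 01WF (base change of projective morphisms).
-/

universe u v

open CategoryTheory AlgebraicGeometry Limits TensorProduct HomogeneousLocalization

noncomputable section

namespace Literature.AlgebraicGeometry.Motives

namespace ProjBaseChange

/-! ### `R`-algebra structure on homogeneous localizations of a graded `R`-algebra -/

section AlgebraInstance

variable {ι R A : Type*} [CommRing R] [CommRing A] [Algebra R A] [DecidableEq ι]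
  [AddCommMonoid ι] (𝒜 : ι → Submodule R A) [GradedAlgebra 𝒜] (x : Submonoid A)

/-- For `r ∈ R`, the element `r/1 ∈ A⁰ₓ` (Mathlib `fromZeroRingHom` applied to `r ∈ 𝒜 0`) maps to
`r/1 ∈ Aₓ`. [folklore] -/
theorem val_fromZeroRingHom_algebraMap (r : R) :
    (fromZeroRingHom 𝒜 x (algebraMap R (𝒜 0) r)).val = algebraMap R (Localization x) r := by
  rw [← Localization.mk_algebraMap]
  simp [fromZeroRingHom]
  rfl

/-- For a graded `R`-algebra `A = ⨁ 𝒜 i` and a submonoid `x`, the homogeneous localization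
`A⁰ₓ` is an `R`-algebra through `R → 𝒜 0 → A⁰ₓ` (Mathlib only records the `𝒜 0`-algebra
structure; the scalar multiplication is Mathlib's `HomogeneousLocalization.instSMul`). [folklore] -/
@[reducible]
def algebraBase : Algebra R (HomogeneousLocalization 𝒜 x) where
  algebraMap := (algebraMap (𝒜 0) (HomogeneousLocalization 𝒜 x)).comp (algebraMap R (𝒜 0))
  commutes' _ _ := mul_comm _ _
  smul_def' r y := by
    apply val_injective
    rw [val_smul, val_mul, Algebra.smul_def, RingHom.comp_apply, algebraMap_eq,
      val_fromZeroRingHom_algebraMap]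

attribute [local instance] algebraBase

/-- The structure map `R → A⁰ₓ` followed by `A⁰ₓ → Aₓ` is the structure map of `Aₓ`. [folklore] -/
@[simp]
theorem val_algebraMap (r : R) :
    (algebraMap R (HomogeneousLocalization 𝒜 x) r).val = algebraMap R (Localization x) r :=
  val_fromZeroRingHom_algebraMap 𝒜 x r

/-- The structure map `R → A⁰ₓ` is `r ↦ r/1` (unfolding lemma, `rfl`). [folklore] -/
theorem algebraMap_eq' (r : R) :
    algebraMap R (HomogeneousLocalization 𝒜 x) r =
      HomogeneousLocalization.mk ⟨0, algebraMap R (𝒜 0) r, 1, one_mem _⟩ := rfl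

/-- `R → A⁰ₓ → Aₓ` is a scalar tower. [folklore] -/
theorem isScalarTower_localization :
    IsScalarTower R (HomogeneousLocalization 𝒜 x) (Localization x) :=
  ⟨fun r y z ↦ by
    change (r • y).val * z = r • (y.val * z)
    rw [val_smul, smul_mul_assoc]⟩

end AlgebraInstance

/-! ### Base change of polynomial rings and of their homogeneous localizations -/

section MvPoly

open MvPolynomial

attribute [local instance] MvPolynomial.gradedAlgebra MvPolynomial.algebraMvPolynomial algebraBase

variable (k L : Type u) [Field k] [Field L] [Algebra k L] (ι : Type v)

/-- `MvPolynomial.map (algebraMap k L) : k[xᵢ] → L[xᵢ]` as a graded ring homomorphism for the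
gradings by total degree (it preserves homogeneity: Mathlib `IsHomogeneous.map`). [folklore] -/
def mapGraded : homogeneousSubmodule ι k →+*ᵍ homogeneousSubmodule ι L where
  __ := MvPolynomial.map (algebraMap k L)
  map_mem hx := hx.map _

/-- `mapGraded` is `MvPolynomial.map (algebraMap k L)` on elements (`rfl`). [folklore] -/
theorem mapGraded_apply (p : MvPolynomial ι k) :
    mapGraded k L ι p = MvPolynomial.map (algebraMap k L) p := rfl

/-- `mapGraded` fixes the monic monomials `xᵐ`. [folklore] -/
theorem mapGraded_monomial_one (m : ι →₀ ℕ) :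
    mapGraded k L ι (monomial m 1) = monomial m 1 := by
  simp [mapGraded_apply, map_monomial]

/-- The monomials occurring in a homogeneous polynomial of degree `n` have degree `n`. [folklore] -/
theorem degree_eq_of_mem_support {K : Type*} [CommSemiring K] {p : MvPolynomial ι K} {n : ℕ}
    (hp : p ∈ homogeneousSubmodule ι K n) {m : ι →₀ ℕ} (hm : m ∈ p.support) : m.degree = n := by
  rw [Finsupp.degree_eq_weight_one]
  exact hp (mem_support_iff.mp hm)

open HomogeneousIdeal in
/-- The irrelevant ideal of `L[xᵢ]` is generated by the image of that of `k[xᵢ]` (both are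
generated by the variables); this is `φ(B₊)E = E₊` in the proof of Liu 2002, Prop. 3.1.9, and the
hypothesis of Mathlib's `Proj.map`. [cite: Liu2002, Prop. 3.1.9 (proof)] -/
theorem irrelevant_le_map :
    (homogeneousSubmodule ι L)₊ ≤ ((homogeneousSubmodule ι k)₊).map (mapGraded k L ι) := by
  rw [← toIdeal_le_toIdeal_iff, irrelevant_eq_span, Ideal.span_le, toIdeal_map]
  intro x hx
  simp only [Set.mem_iUnion, SetLike.mem_coe, exists_prop] at hx
  obtain ⟨i, hi, hx⟩ := hx
  rw [SetLike.mem_coe, MvPolynomial.as_sum x]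
  refine Ideal.sum_mem _ fun m hm ↦ ?_
  have hmon : monomial m (coeff m x) = C (coeff m x) * mapGraded k L ι (monomial m 1) := by
    rw [mapGraded_monomial_one, C_mul_monomial, mul_one]
  rw [hmon]
  refine Ideal.mul_mem_left _ _ (Ideal.mem_map_of_mem _ ?_)
  exact mem_irrelevant_of_mem _ hi (isHomogeneous_monomial (R := k) 1 (degree_eq_of_mem_support ι hx hm))

variable {ι} (s : MvPolynomial ι k)

variable {s} in
/-- On `Aₛ`, the base-change map of homogeneous localizations (Mathlib
`HomogeneousLocalization.Away.map`) is the base-change map of localizations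
`k[xᵢ][1/s] → L[xᵢ][1/s]` (Mathlib `Localization.awayMap`). [folklore] -/
theorem val_awayMap (a : Away (homogeneousSubmodule ι k) s) :
    (Away.map (mapGraded k L ι) s a).val =
      Localization.awayMap (mapGraded k L ι : MvPolynomial ι k →+* MvPolynomial ι L) s a.val := by
  obtain ⟨c, rfl⟩ := mk_surjective a
  rw [Away.map, map_mk, val_mk, val_mk, Localization.mk_eq_mk', Localization.mk_eq_mk',
    Localization.awayMap, IsLocalization.Away.map, IsLocalization.map_mk']
  rfl

/-- `L[xᵢ][1/s]` as an algebra over `k[xᵢ][1/s]` (through Mathlib `Localization.awayMap`);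
an auxiliary local instance. [folklore] -/
@[reducible]
def algebraLocalizationAway : Algebra (Localization.Away s)
    (Localization.Away ((mapGraded k L ι : MvPolynomial ι k →+* MvPolynomial ι L) s)) :=
  (Localization.awayMap (mapGraded k L ι : MvPolynomial ι k →+* MvPolynomial ι L) s).toAlgebra

attribute [local instance] algebraLocalizationAway

/-- `k[xᵢ] → k[xᵢ][1/s] → L[xᵢ][1/s]` is `k[xᵢ] → L[xᵢ] → L[xᵢ][1/s]`
(Mathlib `IsLocalization.map_eq`). [folklore] -/
theorem algebraMap_localizationAway (p : MvPolynomial ι k) :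
    algebraMap (MvPolynomial ι k)
        (Localization.Away ((mapGraded k L ι : MvPolynomial ι k →+* MvPolynomial ι L) s)) p =
      algebraMap (Localization.Away s) _ (algebraMap (MvPolynomial ι k) (Localization.Away s) p) := by
  rw [RingHom.algebraMap_toAlgebra, Localization.awayMap, IsLocalization.Away.map,
    IsLocalization.map_eq, IsScalarTower.algebraMap_apply (MvPolynomial ι k) (MvPolynomial ι L)
      (Localization.Away ((mapGraded k L ι : MvPolynomial ι k →+* MvPolynomial ι L) s))]
  rfl

/-- `k[xᵢ] → k[xᵢ][1/s] → L[xᵢ][1/s]` is a scalar tower. [folklore] -/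
theorem isScalarTower_localizationAway :
    IsScalarTower (MvPolynomial ι k) (Localization.Away s)
      (Localization.Away ((mapGraded k L ι : MvPolynomial ι k →+* MvPolynomial ι L) s)) :=
  IsScalarTower.of_algebraMap_eq (algebraMap_localizationAway k L s)

/-- `k → k[xᵢ][1/s] → L[xᵢ][1/s]` is a scalar tower. [folklore] -/
theorem isScalarTower_localizationAway' :
    IsScalarTower k (Localization.Away s)
      (Localization.Away ((mapGraded k L ι : MvPolynomial ι k →+* MvPolynomial ι L) s)) := by
  refine IsScalarTower.of_algebraMap_eq fun r ↦ ?_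
  rw [IsScalarTower.algebraMap_apply k (MvPolynomial ι k) (Localization.Away s),
    ← algebraMap_localizationAway, ← IsScalarTower.algebraMap_apply]

attribute [local instance] isScalarTower_localizationAway isScalarTower_localizationAway'

/-- `k[xᵢ][1/s] ⊗ₖ L = L[xᵢ][1/s]`: localization commutes with base change (Mathlib
`Algebra.isPushout_of_isLocalization`) and `k[xᵢ] ⊗ₖ L = L[xᵢ]` (Mathlib), composed
(Liu 2002, proof of Prop. 3.1.9: `B_f ⊗_A C ≃ E_{φ(f)}`, his Exercise 1.2.2). [cite: Liu2002, Prop. 3.1.9 (proof)] -/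
theorem isPushout_localizationAway :
    Algebra.IsPushout k (Localization.Away s) L
      (Localization.Away ((mapGraded k L ι : MvPolynomial ι k →+* MvPolynomial ι L) s)) := by
  set B' := Localization.Away ((mapGraded k L ι : MvPolynomial ι k →+* MvPolynomial ι L) s)
  haveI : IsLocalization (Algebra.algebraMapSubmonoid (MvPolynomial ι L) (.powers s)) B' := by
    rw [Algebra.algebraMapSubmonoid_powers, MvPolynomial.algebraMap_def]
    exact Localization.isLocalization
  have h1 : Algebra.IsPushout (MvPolynomial ι k) (MvPolynomial ι L) (Localization.Away s) B' :=
    Algebra.isPushout_of_isLocalization (.powers s) (Localization.Away s) (MvPolynomial ι L) B'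
  exact (Algebra.IsPushout.comp_iff (T := Localization.Away s) (S' := MvPolynomial ι L)
    (T' := B') k (MvPolynomial ι k) L).mpr h1.symm

/-- `L[xᵢ]⁰_(t)` as a `k`-algebra, by restriction of scalars along `k → L`. A plain definition
(used through `letI`), not an instance: for `k = L` it would compete with `algebraBase`. [folklore] -/
@[reducible]
def algebraRestrict (t : MvPolynomial ι L) : Algebra k (Away (homogeneousSubmodule ι L) t) :=
  ((algebraMap L (Away (homogeneousSubmodule ι L) t)).comp (algebraMap k L)).toAlgebra

/-- `k → L → L[xᵢ]⁰_(t)` is a scalar tower for `algebraRestrict` (by construction). [folklore] -/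
theorem isScalarTower_algebraRestrict (t : MvPolynomial ι L) :
    letI := algebraRestrict k L t
    IsScalarTower k L (Away (homogeneousSubmodule ι L) t) :=
  letI := algebraRestrict k L t
  IsScalarTower.of_algebraMap_eq (R := k) (S := L) (A := Away (homogeneousSubmodule ι L) t)
    fun _ ↦ rfl

/-! In the rest of this section `L[xᵢ]⁰_(s)` carries any `k`-algebra structure compatible with its
`L`-algebra structure (in applications: `algebraRestrict`). -/

variable [Algebra k (Away (homogeneousSubmodule ι L) (mapGraded k L ι s))]
  [IsScalarTower k L (Away (homogeneousSubmodule ι L) (mapGraded k L ι s))]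

/-- The base-change map `k[xᵢ]⁰_(s) → L[xᵢ]⁰_(s)` on homogeneous localizations (Mathlib
`HomogeneousLocalization.Away.map`; the map `D₊(φ f) → D₊(f)` in the proof of Liu 2002,
Prop. 3.1.9) is a `k`-algebra homomorphism. [cite: Liu2002, Prop. 3.1.9 (proof)] -/
def awayMapₐ : Away (homogeneousSubmodule ι k) s →ₐ[k]
    Away (homogeneousSubmodule ι L) (mapGraded k L ι s) where
  __ := Away.map (mapGraded k L ι) s
  commutes' r := by
    apply val_injective
    change (Away.map (mapGraded k L ι) s (algebraMap k _ r)).val = _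
    rw [IsScalarTower.algebraMap_apply k L (Away (homogeneousSubmodule ι L) (mapGraded k L ι s)),
      val_algebraMap, algebraMap_eq', Away.map, map_mk, val_mk]
    simp only [SetLike.GradeZero.coe_algebraMap, MvPolynomial.algebraMap_eq]
    rw [IsScalarTower.algebraMap_apply L (MvPolynomial ι L) (Localization _),
      ← Localization.mk_algebraMap]
    congr 1
    · simp [mapGraded_apply, map_C]
    · ext; simp

/-- `awayMapₐ` is `Away.map` on elements (`rfl`). [folklore] -/
@[simp]
theorem awayMapₐ_apply (a : Away (homogeneousSubmodule ι k) s) :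
    awayMapₐ k L s a = Away.map (mapGraded k L ι) s a := rfl

/-- The comparison map `ψ : k[xᵢ]⁰_(s) ⊗ₖ L → L[xᵢ]⁰_(s)`, `(a/sⁿ) ⊗ c ↦ c·a/sⁿ`
(Liu 2002, proof of Prop. 3.1.9). [cite: Liu2002, Prop. 3.1.9 (proof)] -/
def tensorToAway : Away (homogeneousSubmodule ι k) s ⊗[k] L →ₐ[k]
    Away (homogeneousSubmodule ι L) (mapGraded k L ι s) :=
  Algebra.TensorProduct.lift (awayMapₐ k L s) (IsScalarTower.toAlgHom k L _) fun _ _ ↦ .all _ _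

/-- `ψ ((a/sⁿ) ⊗ c) = φ(a)/φ(s)ⁿ · c` (Liu 2002, proof of Prop. 3.1.9). [cite: Liu2002, Prop. 3.1.9 (proof)] -/
@[simp]
theorem tensorToAway_tmul (a : Away (homogeneousSubmodule ι k) s) (c : L) :
    tensorToAway k L s (a ⊗ₜ c) = Away.map (mapGraded k L ι) s a * algebraMap L _ c :=
  Algebra.TensorProduct.lift_tmul ..

variable {s} in
/-- `ψ` is surjective: a homogeneous `a ∈ L[xᵢ]` of degree `n·deg s` is an `L`-linear combination
of monomials, which come from `k[xᵢ]` (Liu 2002, proof of Prop. 3.1.9: "It is clear that `ψ` … is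
surjective"). [cite: Liu2002, Prop. 3.1.9 (proof)] -/
theorem tensorToAway_surjective {d : ℕ} (hs : s ∈ homogeneousSubmodule ι k d) :
    Function.Surjective (tensorToAway k L s) := by
  intro z
  have hFs : mapGraded k L ι s ∈ homogeneousSubmodule ι L d := (mapGraded k L ι).map_mem hs
  obtain ⟨n, a, ha, rfl⟩ := Away.mk_surjective (homogeneousSubmodule ι L) hFs z
  set S : Set (MvPolynomial ι L) := {p | ∃ m : ι →₀ ℕ, m.degree = n • d ∧ p = monomial m 1}
  have hS : Submodule.span L S ≤ homogeneousSubmodule ι L (n • d) := by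
    refine Submodule.span_le.mpr ?_
    rintro _ ⟨m, hm, rfl⟩
    exact isHomogeneous_monomial 1 hm
  have haS : a ∈ Submodule.span L S := by
    rw [MvPolynomial.as_sum a]
    refine Submodule.sum_mem _ fun m hm ↦ ?_
    rw [← mul_one (coeff m a), ← smul_eq_mul, ← smul_monomial]
    exact Submodule.smul_mem _ _ (Submodule.subset_span ⟨m, degree_eq_of_mem_support ι ha hm, rfl⟩)
  suffices h : ∀ p (hp : p ∈ Submodule.span L S),
      Away.mk _ hFs n p (hS hp) ∈ (tensorToAway k L s).range by
    obtain ⟨y, hy⟩ := h a haS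
    exact ⟨y, hy⟩
  intro p hp
  induction hp using Submodule.span_induction with
  | mem p hp =>
    obtain ⟨m, hm, rfl⟩ := hp
    refine ⟨Away.mk _ hs n (monomial m 1) (isHomogeneous_monomial 1 hm) ⊗ₜ 1, ?_⟩
    change tensorToAway k L s _ = _
    rw [tensorToAway_tmul, Away.map_mk]
    apply val_injective
    rw [val_mul, val_algebraMap, (algebraMap L _).map_one, mul_one, Away.val_mk, Away.val_mk]
    congr 1
    exact mapGraded_monomial_one k L ι m
  | zero =>
    have h0 : Away.mk _ hFs n (0 : MvPolynomial ι L) (zero_mem _) = 0 := by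
      apply val_injective
      rw [Away.val_mk, val_zero, Localization.mk_zero]
    rw [h0]
    exact zero_mem _
  | add p q hp hq ihp ihq =>
    have hadd : Away.mk _ hFs n (p + q) (hS (add_mem hp hq)) =
        Away.mk _ hFs n p (hS hp) + Away.mk _ hFs n q (hS hq) := by
      apply val_injective
      rw [val_add, Away.val_mk, Away.val_mk, Away.val_mk, Localization.add_mk_self]
    rw [hadd]
    exact add_mem ihp ihq
  | smul c p hp ih =>
    have h1 : algebraMap L (Away (homogeneousSubmodule ι L) (mapGraded k L ι s)) c ∈
        (tensorToAway k L s).range :=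
      ⟨1 ⊗ₜ c, by change tensorToAway k L s _ = _; rw [tensorToAway_tmul, map_one, one_mul]⟩
    have hsmul : Away.mk _ hFs n (c • p) (hS (Submodule.smul_mem _ c hp)) =
        algebraMap L _ c * Away.mk _ hFs n p (hS hp) := by
      apply val_injective
      rw [val_mul, val_algebraMap, Away.val_mk, Away.val_mk, smul_eq_C_mul,
        IsScalarTower.algebraMap_apply L (MvPolynomial ι L) (Localization _),
        MvPolynomial.algebraMap_eq, ← Localization.mk_algebraMap, Localization.mk_mul]
      congr 1
      exact (one_mul _).symm
    rw [hsmul]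
    exact mul_mem h1 ih

attribute [local instance] isScalarTower_localization

variable {s} in
/-- `ψ` is injective: `A⁰_(s) ⊗ₖ L → A_s ⊗ₖ L` is injective (`L` is flat over `k` and
`A⁰_(s) ⊆ A_s`), `A_s ⊗ₖ L ≃ (A ⊗ₖ L)_s`, and the composite factors through `ψ` followed by the
inclusion `(A ⊗ₖ L)⁰_(s) ⊆ (A ⊗ₖ L)_s` (Liu 2002, proof of Prop. 3.1.9). [cite: Liu2002, Prop. 3.1.9 (proof)] -/
theorem tensorToAway_injective : Function.Injective (tensorToAway k L s) := by
  haveI hP := isPushout_localizationAway k L s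
  set B' := Localization.Away ((mapGraded k L ι : MvPolynomial ι k →+* MvPolynomial ι L) s)
  let θ := Algebra.IsPushout.equiv k (Localization.Away s) L B'
  let v : Away (homogeneousSubmodule ι k) s →ₗ[k] Localization.Away s :=
    (IsScalarTower.toAlgHom k (Away (homogeneousSubmodule ι k) s) (Localization.Away s)).toLinearMap
  have hv : ∀ a, v a = a.val := fun a ↦ rfl
  have key : ∀ x, (tensorToAway k L s x).val = θ (v.rTensor L x) := by
    intro x
    induction x using TensorProduct.induction_on with
    | zero => rw [map_zero, map_zero, map_zero, val_zero]; rfl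
    | tmul a c =>
      rw [tensorToAway_tmul, val_mul, val_algebraMap, LinearMap.rTensor_tmul,
        Algebra.IsPushout.equiv_tmul, RingHom.algebraMap_toAlgebra, hv, val_awayMap]
      rfl
    | add x y hx hy => rw [map_add, val_add, hx, hy, map_add, map_add]; rfl
  intro x y hxy
  have h := congr_arg HomogeneousLocalization.val hxy
  rw [key, key] at h
  exact Module.Flat.rTensor_preserves_injective_linearMap (M := L) v
    (fun a b hab ↦ val_injective _ (by rwa [← hv, ← hv])) (θ.injective h)

variable {s} in
/-- `ψ : k[xᵢ]⁰_(s) ⊗ₖ L ≃ L[xᵢ]⁰_(s)` for `s` homogeneous (Liu 2002, Prop. 3.1.9, the key step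
of its proof, in the case `B = k[x₀,…,x_N]`, `C = L`). [cite: Liu2002, Prop. 3.1.9 (proof)] -/
theorem tensorToAway_bijective {d : ℕ} (hs : s ∈ homogeneousSubmodule ι k d) :
    Function.Bijective (tensorToAway k L s) :=
  ⟨tensorToAway_injective k L, tensorToAway_surjective k L hs⟩

end MvPoly

/-! ### Projective space commutes with base change -/

section Proj

open MvPolynomial HomogeneousIdeal

attribute [local instance] MvPolynomial.gradedAlgebra algebraBase

-- `ι : Type` (universe `0`), so that `Proj k[xᵢ]` and `Spec k` live in the same universe `u`.
variable (k L : Type u) [Field k] [Field L] [Algebra k L] (ι : Type)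

/-- The ring isomorphism `ψ : k[xᵢ]⁰_(s) ⊗ₖ L ≅ L[xᵢ]⁰_(s)` in `CommRingCat`
(Liu 2002, proof of Prop. 3.1.9). [cite: Liu2002, Prop. 3.1.9 (proof)] -/
def tensorAwayIso {d : ℕ} (s : MvPolynomial ι k) (hs : s ∈ homogeneousSubmodule ι k d) :
    CommRingCat.of (Away (homogeneousSubmodule ι k) s ⊗[k] L) ≅
      CommRingCat.of (Away (homogeneousSubmodule ι L) (mapGraded k L ι s)) :=
  letI := algebraRestrict k L (mapGraded k L ι s)
  haveI := isScalarTower_algebraRestrict k L (mapGraded k L ι s)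
  (RingEquiv.ofBijective (tensorToAway k L s).toRingHom (tensorToAway_bijective k L hs)).toCommRingCatIso

/-- `k → k[xᵢ]⁰_(s)`, `k → L`, `k[xᵢ]⁰_(s) → L[xᵢ]⁰_(s)`, `L → L[xᵢ]⁰_(s)` is a pushout square of
commutative rings (Liu 2002, proof of Prop. 3.1.9). [cite: Liu2002, Prop. 3.1.9 (proof)] -/
theorem isPushout_away {d : ℕ} (s : MvPolynomial ι k) (hs : s ∈ homogeneousSubmodule ι k d) :
    IsPushout (CommRingCat.ofHom (algebraMap k (Away (homogeneousSubmodule ι k) s)))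
      (CommRingCat.ofHom (algebraMap k L))
      (CommRingCat.ofHom (Away.map (mapGraded k L ι) s))
      (CommRingCat.ofHom (algebraMap L (Away (homogeneousSubmodule ι L) (mapGraded k L ι s)))) := by
  letI := algebraRestrict k L (mapGraded k L ι s)
  haveI := isScalarTower_algebraRestrict k L (mapGraded k L ι s)
  refine (CommRingCat.isPushout_tensorProduct k (Away (homogeneousSubmodule ι k) s) L).of_iso
    (Iso.refl _) (Iso.refl _) (Iso.refl _) (tensorAwayIso k L ι s hs) (by simp) (by simp) ?_ ?_
  · refine CommRingCat.hom_ext (RingHom.ext fun a ↦ ?_)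
    change tensorToAway k L s (a ⊗ₜ 1) = Away.map (mapGraded k L ι) s a
    rw [tensorToAway_tmul, map_one, mul_one]
  · refine CommRingCat.hom_ext (RingHom.ext fun c ↦ ?_)
    change tensorToAway k L s (1 ⊗ₜ c) = algebraMap L _ c
    rw [tensorToAway_tmul, map_one, one_mul]

/-- `D₊(s) ⊆ ℙ_L` is the fibre product `D₊(s) ×_k L` (with `D₊(s) ⊆ ℙ_k`): the affine square
`Spec` of `isPushout_away` (Liu 2002, proof of Prop. 3.1.9: "`D₊(φ(f)) → D₊(f) ×_{Spec A} Spec C`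
is an isomorphism"). [cite: Liu2002, Prop. 3.1.9 (proof)] -/
theorem isPullback_Spec_away {d : ℕ} (s : MvPolynomial ι k)
    (hs : s ∈ homogeneousSubmodule ι k d) :
    IsPullback (Spec.map (CommRingCat.ofHom (Away.map (mapGraded k L ι) s)))
      (Spec.map (CommRingCat.ofHom
        (algebraMap L (Away (homogeneousSubmodule ι L) (mapGraded k L ι s)))))
      (Spec.map (CommRingCat.ofHom (algebraMap k (Away (homogeneousSubmodule ι k) s))))
      (Spec.map (CommRingCat.ofHom (algebraMap k L))) :=
  isPullback_SpecMap_of_isPushout _ _ _ _ (isPushout_away k L ι s hs)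

variable {k L} in
/-- The structure morphism `ℙ(ι)_K = Proj K[xᵢ] → Spec (K[xᵢ])₀ → Spec K` used in
`Literature.AlgebraicGeometry.Motives.projectiveSpace`. [folklore] -/
abbrev projToSpec (K : Type u) [Field K] :
    Proj (homogeneousSubmodule ι K) ⟶ Spec (.of K) :=
  Proj.toSpecZero (homogeneousSubmodule ι K) ≫
    Spec.map (CommRingCat.ofHom (algebraMap K (homogeneousSubmodule ι K 0)))

variable {k L} in
/-- On the chart `D₊(t) = Spec K[xᵢ]⁰_(t)` the structure morphism to `Spec K` is `Spec` of the
structure map `K → K[xᵢ]⁰_(t)` (Mathlib `Proj.awayι_toSpecZero`). [folklore] -/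
theorem awayι_projToSpec {K : Type u} [Field K] {t : MvPolynomial ι K} {d : ℕ}
    (ht : t ∈ homogeneousSubmodule ι K d) (hd : 0 < d) :
    Proj.awayι (homogeneousSubmodule ι K) t ht hd ≫ projToSpec ι K =
      Spec.map (CommRingCat.ofHom (algebraMap K (Away (homogeneousSubmodule ι K) t))) := by
  rw [Proj.awayι_toSpecZero_assoc, ← Spec.map_comp, ← CommRingCat.ofHom_comp]

/-- **`ℙ(ι)_L = ℙ(ι)_k ×_{Spec k} Spec L`.** The square formed by `Proj` of the base-change map
`k[xᵢ] → L[xᵢ]` (Mathlib `Proj.map`) and the structure morphisms is cartesian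
(Liu 2002, Prop. 3.1.9 with `B = k[xᵢ]`, `C = L`, and Example 3.1.10 `(ℙⁿ_A)_C = ℙⁿ_C`).
Proof as in Liu: it suffices to check over the charts `D₊(s)` (Mathlib
`Scheme.isPullback_of_openCover` for `Proj.affineOpenCover`, and `Proj.awayι_comp_map`,
`Proj.map_preimage_basicOpen` for `h⁻¹(D₊(f) × C) = D₊(φ f)`), where it is
`isPullback_Spec_away`. [cite: Liu2002, Prop. 3.1.9 and Ex. 3.1.10] -/
theorem isPullback_projMap :
    IsPullback (Proj.map (mapGraded k L ι) (irrelevant_le_map k L ι)) (projToSpec ι L)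
      (projToSpec ι k) (Spec.map (CommRingCat.ofHom (algebraMap k L))) := by
  refine Scheme.isPullback_of_openCover _ _ _ _
    (Proj.affineOpenCover (homogeneousSubmodule ι k)).openCover fun i ↦ ?_
  have hd : 0 < (i.1 : ℕ) := i.1.2
  have hs : (i.2 : MvPolynomial ι k) ∈ homogeneousSubmodule ι k i.1 := i.2.2
  have hopen : IsPullback
      (Spec.map (CommRingCat.ofHom (Away.map (mapGraded k L ι) (i.2 : MvPolynomial ι k))))
      (Proj.awayι (homogeneousSubmodule ι L) (mapGraded k L ι (i.2 : MvPolynomial ι k))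
        ((mapGraded k L ι).map_mem hs) hd)
      (Proj.awayι (homogeneousSubmodule ι k) (i.2 : MvPolynomial ι k) hs hd)
      (Proj.map (mapGraded k L ι) (irrelevant_le_map k L ι)) :=
    IsOpenImmersion.isPullback _ _ _ _ (Proj.awayι_comp_map _ _ hd _ hs)
      (by rw [Proj.opensRange_awayι, Proj.opensRange_awayι, Proj.map_preimage_basicOpen])
  have hSpec := isPullback_Spec_away k L ι (i.2 : MvPolynomial ι k) hs
  refine hSpec.of_iso hopen.flip.isoPullback (Iso.refl _) (Iso.refl _) (Iso.refl _) ?_ ?_ ?_ ?_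
  · exact (Category.comp_id _).trans hopen.flip.isoPullback_hom_snd.symm
  · exact (Category.comp_id _).trans
      ((awayι_projToSpec ι ((mapGraded k L ι).map_mem hs) hd).symm.trans
        ((congrArg (· ≫ projToSpec ι L) hopen.flip.isoPullback_hom_fst.symm).trans
          (Category.assoc _ _ _)))
  · exact (Category.comp_id _).trans
      ((awayι_projToSpec ι hs hd).symm.trans (Category.id_comp _).symm)
  · simp

end Proj

end ProjBaseChange

/-! ### Base change of projective and of smooth projective `k`-schemes -/

section Varieties

open MonoidalCategory

attribute [local instance] MvPolynomial.gradedAlgebra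

variable (k L : Type u) [Field k] [Field L] [Algebra k L]

/-- The structure morphism of `Literature.projectiveSpace n K` is `ProjBaseChange.projToSpec` (by `rfl`;
cf. `Literature.NumberTheory.Transcendental.projectiveSpace_hom` in `Transcendental/Analytification`). [folklore] -/
theorem projectiveSpace_hom_eq_projToSpec (n : ℕ) (K : Type u) [Field K] :
    (projectiveSpace n K).hom = ProjBaseChange.projToSpec (Fin (n + 1)) K := rfl

/-- **`ℙⁿ_L ≅ ℙⁿ_k ×_k L` over `L`** (Liu 2002, Example 3.1.10 `(ℙⁿ_A)_C = ℙⁿ_C`), as an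
isomorphism in `SchemeOver L` between `Literature.projectiveSpace n L` and
`Literature.baseChange k L (Literature.projectiveSpace n k)`. [cite: Liu2002, Ex. 3.1.10] -/
def projectiveSpaceBaseChangeIso (n : ℕ) :
    projectiveSpace n L ≅ (Literature.AlgebraicGeometry.Motives.baseChange k L).obj (projectiveSpace n k) :=
  Over.isoMk (ProjBaseChange.isPullback_projMap k L (Fin (n + 1))).isoPullback
    (ProjBaseChange.isPullback_projMap k L (Fin (n + 1))).isoPullback_hom_snd

variable {k} in
/-- For a `k`-morphism `i : X ⟶ Y`, the square `X_L ⟶ Y_L`, `X_L ⟶ X`, `Y_L ⟶ Y`, `i` is cartesian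
(`X ×_S S' = X ×_Y (Y ×_S S')`; Liu 2002, Remark 3.1.20). [cite: Liu2002, Rem. 3.1.20] -/
theorem isPullback_baseChange_map_left {X Y : SchemeOver k} (i : X ⟶ Y) :
    IsPullback ((Literature.AlgebraicGeometry.Motives.baseChange k L).map i).left
      (pullback.fst X.hom (Spec.map (CommRingCat.ofHom (algebraMap k L))))
      (pullback.fst Y.hom (Spec.map (CommRingCat.ofHom (algebraMap k L)))) i.left := by
  refine IsPullback.of_right ?_ (pullback.lift_fst _ _ _)
    (IsPullback.of_hasPullback Y.hom (Spec.map (CommRingCat.ofHom (algebraMap k L)))).flip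
  have h1 : ((Literature.AlgebraicGeometry.Motives.baseChange k L).map i).left ≫
      pullback.snd Y.hom (Spec.map (CommRingCat.ofHom (algebraMap k L))) =
      pullback.snd X.hom (Spec.map (CommRingCat.ofHom (algebraMap k L))) := Over.w _
  have h2 : i.left ≫ Y.hom = X.hom := Over.w i
  rw [h1, h2]
  exact (IsPullback.of_hasPullback X.hom _).flip

variable {k} in
/-- Projective `k`-schemes are stable under extension of the base field: a closed `k`-immersion
`X ↪ ℙⁿ_k` base-changes to a closed `L`-immersion `X_L ↪ (ℙⁿ_k)_L` (Liu 2002, Prop. 3.1.23 with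
Remark 3.1.20; Hartshorne II Ex. 3.11(a)), and `(ℙⁿ_k)_L ≅ ℙⁿ_L` over `L` (Liu 2002, Ex. 3.1.10);
cf. Stacks 01WF. [cite: Liu2002, Prop. 3.1.23 and Ex. 3.1.10] -/
theorem IsProjectiveOver.baseChange_obj {X : SchemeOver k} (h : IsProjectiveOver X) :
    IsProjectiveOver ((Literature.AlgebraicGeometry.Motives.baseChange k L).obj X) := by
  obtain ⟨n, i, hi⟩ := h
  refine ⟨n, (Literature.AlgebraicGeometry.Motives.baseChange k L).map i ≫ (projectiveSpaceBaseChangeIso k L n).inv, ?_⟩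
  have h1 : IsClosedImmersion ((Literature.AlgebraicGeometry.Motives.baseChange k L).map i).left :=
    MorphismProperty.IsStableUnderBaseChange.of_isPullback
      (isPullback_baseChange_map_left L i).flip hi
  have h2 : IsIso (projectiveSpaceBaseChangeIso k L n).inv.left :=
    inferInstanceAs (IsIso ((Over.forget _).map (projectiveSpaceBaseChangeIso k L n).inv))
  rw [Over.comp_left]
  infer_instance

variable {k} in
/-- **Smooth projective varieties are stable under extension of the base field**: smoothness of
relative dimension `n` is stable under base change (Hartshorne III Prop. 10.1(b); Liu 2002,
Prop. 4.3.38; Stacks 01VB; Mathlib `smoothOfRelativeDimension_isStableUnderBaseChange`), so is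
geometric irreducibility (Stacks 054P; Mathlib's instance on `pullback.snd`), and projectivity by
`IsProjectiveOver.baseChange_obj` (Liu 2002, Ex. 3.1.10 and Prop. 3.1.23). This is the content of
the named facts `Literature.AlgebraicGeometry.Motives.IsSmoothProjective.baseChange` and `Literature.AlgebraicGeometry.Motives.IsSmoothProjective.baseChangeHom`. [cite: Liu2002, Ex. 3.1.10 and Prop. 4.3.38] [cite: Hartshorne1977, III Prop. 10.1(b) and II Ex. 3.11(a)] -/
theorem IsSmoothProjective.baseChange_obj {n : ℕ} {X : SchemeOver k} (h : IsSmoothProjective n X) :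
    IsSmoothProjective n ((Literature.AlgebraicGeometry.Motives.baseChange k L).obj X) where
  smoothOfRelativeDimension :=
    have := smoothOfRelativeDimension_isStableUnderBaseChange n
    MorphismProperty.pullback_snd (P := @SmoothOfRelativeDimension n) _ _ h.smoothOfRelativeDimension
  isProjectiveOver := h.isProjectiveOver.baseChange_obj L
  geometricallyIrreducible := by
    have := h.geometricallyIrreducible
    exact inferInstanceAs
      (GeometricallyIrreducible (pullback.snd X.hom (Spec.map (CommRingCat.ofHom (algebraMap k L)))))

end Varieties

/-! ### Discharges of the named facts -/

namespace IsSmoothProjective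

/-- Discharge of the named fact `Literature.AlgebraicGeometry.Motives.IsSmoothProjective.baseChange` (`Motives/Varieties.lean`):
smooth projective varieties are stable under extension of the base field (Liu 2002, Ex. 3.1.10
with Prop. 3.1.23, and Prop. 4.3.38; Hartshorne III Prop. 10.1(b)). [cite: Liu2002, Ex. 3.1.10 and Prop. 4.3.38] -/
theorem baseChange_holds {k : Type u} [Field k] {n : ℕ} {X : SchemeOver k} :
    IsSmoothProjective.baseChange (k := k) (n := n) (X := X) :=
  fun L _ _ hX ↦ hX.baseChange_obj L

/-- Discharge of the named fact `Literature.AlgebraicGeometry.Motives.IsSmoothProjective.baseChangeHom` (`Motives/BaseChange.lean`):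
smooth projective varieties are stable under base change along a homomorphism of fields
`σ : k →+* L`; this is `baseChange_obj` for the algebra structure `σ.toAlgebra`
(`Literature.baseChangeHom σ = Literature.baseChange k L` definitionally, `Literature.AlgebraicGeometry.Motives.baseChangeHom_algebraMap`)
(Liu 2002, Ex. 3.1.10 with Prop. 3.1.23, and Prop. 4.3.38; Hartshorne III Prop. 10.1(b)). [cite: Liu2002, Ex. 3.1.10 and Prop. 4.3.38] -/
theorem baseChangeHom_holds {k L : Type u} [Field k] [Field L] :
    IsSmoothProjective.baseChangeHom (k := k) (L := L) := by
  intro σ n X h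
  letI := σ.toAlgebra
  exact h.baseChange_obj L

/-- Discharge of the named fact `Literature.AlgebraicGeometry.Motives.IsSmoothProjective.conjugateVariety` (`Motives/BaseChange.lean`):
the conjugate `X^τ = X ×_{L,τ} L` of a smooth projective variety by a field automorphism `τ` is
smooth projective of the same dimension (the case `σ = τ` of `baseChangeHom_holds`;
Liu 2002, Ex. 3.1.10 and Prop. 4.3.38; Hartshorne III Prop. 10.1(b)). [cite: Liu2002, Ex. 3.1.10 and Prop. 4.3.38] -/
theorem conjugateVariety_holds : IsSmoothProjective.conjugateVariety.{u} :=
  fun τ _ _ h ↦ baseChangeHom_holds τ.toRingHom h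

end IsSmoothProjective

end Literature.AlgebraicGeometry.Motives

end
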